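import Mathlib
import Summits.NavierStokesRegularity.NavierStokesRegularity.Theorems.EulerZoomLiouvillePowerGaugeEulerLiouvilleWeakEtaRenormalisedMollified
import Summits.NavierStokesRegularity.NavierStokesRegularity.Theorems.EulerZoomLiouvillePowerGaugeEulerLiouvilleWeakChainRuleTools
import Literature.Analysis.FunctionSpaces.MollificationLp
import HarnessLib

/-!
# Crux `EulerZoomLiouville.PowerGaugeEulerLiouville` (stmt-NavierStokesRegularity-19832), weak stratum, line `weak_eulerian` (E2):
# THE RENORMALISED IDENTITY FOR A `C¹` VECTOR FIELD, and local `L¹` convergence of mollifications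

Route №10 `EulerZoomLiouville` (NavierStokesRegularity), crux E = stmt-NavierStokesRegularity-19832; width seat ns-ezl-w2 g7 under the LEAD ns-typeII-p2.
Second brick of `stub_renormalisation` (E2).  Two class-free facts:

* `renormalised_identity_vec` — **VECTOR CHAIN RULE AGAINST `div W = c`**: `W ∈ L¹_loc` with `∫⟪W, ∇θ⟫ = −c∫θ` for all tests
  (`div W = c` in `𝒟′`), `g ∈ C¹(ℝ³; ℝ³)`, `β ∈ C¹(ℝ³; ℝ)`, `ψ` a test ⇒
  `∫ β(g)(cψ + Dψ[W]) = −∫ ψ Dβ(g)[Dg[W]]`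
  (`div W = c` tested with the `C¹_c` function `ψ·β(g)`, the tree's `WeakAxisym.integral_fderiv_apply_eq_of_contDiff_one`;
  the vector twin of `WeakAxisym.renormalised_identity_of_transport`);
* `tendsto_setLIntegral_mollify_sub` — local `L¹` convergence of mollifications of an `L¹_loc` function along a bump sequence
  with `r_φₙ → 0`: `∫_{B(0,M)} ‖φ̃ₙ ⋆ g − g‖ → 0` (exponent-`1` twin of `WeakLagrangian.tendsto_setLIntegral_mollify_sub_rpow`).

[folklore; DiPernaLions1989 §II.1 (proof of Thm. II.1); Evans2010 App. C.4 Thm. 7]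

WHAT THIS IS NOT: not NS, not E, not E2 yet (the limit is the next file); 19832 is OPEN.
-/

noncomputable section

-- flat `Theorems/<Route><Decl>…` files of one crux share the namespace of the crux (tree convention)
set_option linter.dupNamespace false

open MeasureTheory Set Filter Topology Metric Function TopologicalSpace ContinuousLinearMap
open scoped ENNReal NNReal RealInnerProductSpace ContDiff Convolution

namespace Summit.NavierStokesRegularity.NavierStokesRegularity.Theorems.PowerGaugeEulerLiouville.WeakEulerian

open Literature.Analysis Literature.Analysis.FunctionSpaces Literature.Analysis.FluidPDE
open Summit.NavierStokesRegularity.NavierStokesRegularity.Theorems.PowerGaugeEulerLiouville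

section Identity

variable {W : EuclideanSpace ℝ (Fin 3) → EuclideanSpace ℝ (Fin 3)} {c : ℝ}

/-- Chain rule `D(β ∘ g)(y) = Dβ(g y) ∘ Dg(y)` for `β ∈ C¹(ℝ³; ℝ)` and `g ∈ C¹(ℝ³; ℝ³)`. [folklore] -/
theorem hasFDerivAt_beta_comp_vec {β : EuclideanSpace ℝ (Fin 3) → ℝ} (hβ : ContDiff ℝ 1 β)
    {g : EuclideanSpace ℝ (Fin 3) → EuclideanSpace ℝ (Fin 3)} (hg : ContDiff ℝ 1 g) (y : EuclideanSpace ℝ (Fin 3)) :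
    HasFDerivAt (fun y => β (g y)) ((fderiv ℝ β (g y)).comp (fderiv ℝ g y)) y :=
  ((hβ.differentiable (by simp)) _).hasFDerivAt.comp y ((hg.differentiable (by simp)) y).hasFDerivAt

/-- **THE RENORMALISED IDENTITY FOR A `C¹` VECTOR FIELD.**  Let `W ∈ L¹_loc` with `∫⟪W, ∇θ⟫ = −c∫θ` for all tests (`div W = c` in `𝒟′`),
`g ∈ C¹(ℝ³; ℝ³)`, `β ∈ C¹(ℝ³; ℝ)`, `ψ` a test.  Then
`∫ β(g)(cψ + Dψ[W]) = −∫ ψ Dβ(g)[Dg[W]]`  (`div W = c` tested with the `C¹_c` function `ψ·β(g)`).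
[folklore; DiPernaLions1989 §II.1 (proof of Thm. II.1)] -/
theorem renormalised_identity_vec (hWl : LocallyIntegrable W volume)
    (hdiv : ∀ θ : EuclideanSpace ℝ (Fin 3) → ℝ, IsTestFunctionOn (⊤ : Opens (EuclideanSpace ℝ (Fin 3))) θ →
      ∫ y, ⟪W y, gradient θ y⟫ = -c * ∫ y, θ y)
    {g : EuclideanSpace ℝ (Fin 3) → EuclideanSpace ℝ (Fin 3)} (hg : ContDiff ℝ 1 g)
    {β : EuclideanSpace ℝ (Fin 3) → ℝ} (hβ : ContDiff ℝ 1 β)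
    {ψ : EuclideanSpace ℝ (Fin 3) → ℝ} (hψ : IsTestFunctionOn (⊤ : Opens (EuclideanSpace ℝ (Fin 3))) ψ) :
    ∫ y, β (g y) * (c * ψ y + fderiv ℝ ψ y (W y)) = -∫ y, ψ y * fderiv ℝ β (g y) (fderiv ℝ g y (W y)) := by
  -- ### data
  have hgc : Continuous g := hg.continuous
  have hDgc : Continuous (fderiv ℝ g) := hg.continuous_fderiv one_ne_zero
  have hψc : Continuous ψ := hψ.contDiff.continuous
  have hDψc : Continuous (fderiv ℝ ψ) := hψ.contDiff.continuous_fderiv (by simp)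
  have hβc : Continuous β := hβ.continuous
  have hDβc : Continuous (fderiv ℝ β) := hβ.continuous_fderiv one_ne_zero
  -- ### the `C¹_c` test `θ = ψ · β(g)`
  have hβg : ContDiff ℝ 1 (fun y => β (g y)) := hβ.comp hg
  have hθ1 : ContDiff ℝ 1 (fun y => ψ y * β (g y)) := (hψ.contDiff.of_le (by norm_cast)).mul hβg
  have hθs : HasCompactSupport (fun y => ψ y * β (g y)) := by
    refine hψ.hasCompactSupport.mono fun y hy => ?_
    rw [mem_support] at hy ⊢
    intro h; exact hy (by rw [h, zero_mul])
  have hDθ : ∀ y w, fderiv ℝ (fun y => ψ y * β (g y)) y w =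
      β (g y) * fderiv ℝ ψ y w + ψ y * fderiv ℝ β (g y) (fderiv ℝ g y w) := by
    intro y w
    have h1 : HasFDerivAt ψ (fderiv ℝ ψ y) y := ((hψ.contDiff.differentiable (by simp)) y).hasFDerivAt
    have h2 := hasFDerivAt_beta_comp_vec hβ hg y
    have h3 : HasFDerivAt (fun y => ψ y * β (g y))
        (ψ y • ((fderiv ℝ β (g y)).comp (fderiv ℝ g y)) + β (g y) • fderiv ℝ ψ y) y := h1.mul h2
    rw [h3.fderiv]
    simp only [_root_.add_apply, _root_.smul_apply, smul_eq_mul, ContinuousLinearMap.coe_comp, Function.comp_apply]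
    ring
  have hdivθ : ∫ y, fderiv ℝ (fun y => ψ y * β (g y)) y (W y) = -c * ∫ y, ψ y * β (g y) :=
    WeakAxisym.integral_fderiv_apply_eq_of_contDiff_one (c := c) hWl hdiv hθ1 hθs
  -- ### integrability of the pieces
  have hL1c : Continuous fun y => β (g y) • fderiv ℝ ψ y := (hβc.comp hgc).smul hDψc
  have hL1s : HasCompactSupport fun y => β (g y) • fderiv ℝ ψ y := by
    refine (hψ.hasCompactSupport.fderiv (𝕜 := ℝ)).mono fun y hy => ?_
    rw [mem_support] at hy ⊢
    intro h; exact hy (by rw [h, smul_zero])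
  have hI1 : Integrable (fun y => β (g y) * fderiv ℝ ψ y (W y)) volume := by
    have h := WeakEulerian.integrable_clm_apply_of_locallyIntegrable hL1c hL1s hWl
    refine h.congr (Eventually.of_forall fun y => ?_)
    simp only [_root_.smul_apply, smul_eq_mul]
  have hL2c : Continuous fun y => ψ y • ((fderiv ℝ β (g y)).comp (fderiv ℝ g y)) :=
    hψc.smul ((hDβc.comp hgc).clm_comp hDgc)
  have hL2s : HasCompactSupport fun y => ψ y • ((fderiv ℝ β (g y)).comp (fderiv ℝ g y)) := by
    refine hψ.hasCompactSupport.mono fun y hy => ?_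
    rw [mem_support] at hy ⊢
    intro h; exact hy (by rw [h, zero_smul])
  have hI2 : Integrable (fun y => ψ y * fderiv ℝ β (g y) (fderiv ℝ g y (W y))) volume := by
    have h := WeakEulerian.integrable_clm_apply_of_locallyIntegrable hL2c hL2s hWl
    refine h.congr (Eventually.of_forall fun y => ?_)
    simp only [_root_.smul_apply, smul_eq_mul, ContinuousLinearMap.coe_comp, Function.comp_apply]
  have hI3 : Integrable (fun y => ψ y * β (g y)) volume := (hψc.mul (hβc.comp hgc)).integrable_of_hasCompactSupport hθs
  -- ### the divergence identity, expanded
  have e1 : ∫ y, fderiv ℝ (fun y => ψ y * β (g y)) y (W y) =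
      (∫ y, β (g y) * fderiv ℝ ψ y (W y)) + ∫ y, ψ y * fderiv ℝ β (g y) (fderiv ℝ g y (W y)) := by
    rw [← integral_add hI1 hI2]
    exact integral_congr_ae (Eventually.of_forall fun y => hDθ y (W y))
  rw [e1] at hdivθ
  have eL : ∫ y, β (g y) * (c * ψ y + fderiv ℝ ψ y (W y)) =
      c * (∫ y, ψ y * β (g y)) + ∫ y, β (g y) * fderiv ℝ ψ y (W y) := by
    rw [← integral_const_mul, ← integral_add (hI3.const_mul _) hI1]
    refine integral_congr_ae (Eventually.of_forall fun y => ?_)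
    ring
  rw [eL]
  linarith

end Identity

section L1loc

variable {F : Type*} [NormedAddCommGroup F] [NormedSpace ℝ F] [CompleteSpace F]

/-- **Local `L¹` convergence of mollifications**: `g ∈ L¹_loc`; then along any bump sequence with `r_φₙ → 0`,
`∫_{B(0,M)} ‖φ̃ₙ ⋆ g − g‖ → 0` (exponent-`1` twin of `WeakLagrangian.tendsto_setLIntegral_mollify_sub_rpow`).
[folklore; Evans2010 App. C.4 Thm. 7 (iii)] -/
theorem tendsto_setLIntegral_mollify_sub {φ : ℕ → ContDiffBump (0 : EuclideanSpace ℝ (Fin 3))}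
    (hφ : Tendsto (fun n => (φ n).rOut) atTop (𝓝 0)) {g : EuclideanSpace ℝ (Fin 3) → F}
    (hg : LocallyIntegrable g volume) (M : ℝ) :
    Tendsto (fun n => ∫⁻ z in ball (0 : EuclideanSpace ℝ (Fin 3)) M, ‖((φ n).normed volume ⋆[lsmul ℝ ℝ, volume] g) z - g z‖ₑ)
      atTop (𝓝 0) := by
  set ψ : EuclideanSpace ℝ (Fin 3) → F := (ball (0 : EuclideanSpace ℝ (Fin 3)) (M + 1)).indicator g with hψ
  have hψi : Integrable ψ volume :=
    ((hg.integrableOn_isCompact (isCompact_closedBall (0 : EuclideanSpace ℝ (Fin 3)) (M + 1))).mono_set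
      ball_subset_closedBall).integrable_indicator measurableSet_ball
  have hψm : MemLp ψ 1 volume := memLp_one_iff_integrable.2 hψi
  have hconv := FunctionSpaces.tendsto_eLpNorm_normed_convolution_sub_self (μ := (volume : Measure (EuclideanSpace ℝ (Fin 3))))
    hφ le_rfl ENNReal.one_ne_top hψm
  simp_rw [eLpNorm_one_eq_lintegral_enorm] at hconv
  have hsmall : ∀ᶠ n in atTop, (φ n).rOut ≤ 1 := (hφ.eventually (gt_mem_nhds one_pos)).mono fun n hn => hn.le
  refine tendsto_of_tendsto_of_tendsto_of_le_of_le' tendsto_const_nhds hconv (Eventually.of_forall fun n => bot_le) ?_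
  filter_upwards [hsmall] with n hn
  have heq : ∀ z ∈ ball (0 : EuclideanSpace ℝ (Fin 3)) M,
      ‖((φ n).normed volume ⋆[lsmul ℝ ℝ, volume] g) z - g z‖ₑ = ‖((φ n).normed volume ⋆[lsmul ℝ ℝ, volume] ψ - ψ) z‖ₑ := by
    intro z hz
    have hzM : z ∈ ball (0 : EuclideanSpace ℝ (Fin 3)) (M + 1) := ball_subset_ball (by linarith) hz
    have hsub : ball z (φ n).rOut ⊆ ball (0 : EuclideanSpace ℝ (Fin 3)) (M + 1) := by
      intro t ht
      rw [mem_ball, dist_zero_right]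
      rw [mem_ball, dist_eq_norm] at ht
      rw [mem_ball, dist_zero_right] at hz
      calc ‖t‖ = ‖(t - z) + z‖ := by rw [sub_add_cancel]
        _ ≤ ‖t - z‖ + ‖z‖ := norm_add_le _ _
        _ < M + 1 := by linarith
    rw [Pi.sub_apply, hψ, WeakLagrangian.normed_convolution_indicator_eq (φ n) hsub, indicator_of_mem hzM]
  rw [setLIntegral_congr_fun measurableSet_ball heq]
  exact setLIntegral_le_lintegral _ _

end L1loc


end Summit.NavierStokesRegularity.NavierStokesRegularity.Theorems.PowerGaugeEulerLiouville.WeakEulerian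

end
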